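import Literature.Topology.FourManifolds.RegularLevelSplitting
import Literature.Topology.FourManifolds.BoundarySignature
import Literature.Geometry.Manifold.SmoothEmbeddingInverse
import Mathlib.Analysis.SpecialFunctions.SmoothTransition
import Mathlib.Analysis.InnerProductSpace.Calculus
import Mathlib.Analysis.Normed.Module.Connected
import Mathlib.Analysis.Normed.Module.Ball.Homeomorph
import Mathlib.Analysis.SpecialFunctions.Complex.Circle
import Mathlib.Analysis.InnerProductSpace.PiL2
import HarnessLib

/-!
# Splitting a closed manifold along the boundary of a tube `F × D`

Let `Y` be a manifold without boundary (model `𝓡 (k + 1)`), `F` a compact manifold without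
boundary (model `𝓡 d`) and `T : F × ℝᶜ → Y` a smooth open embedding — a (trivialised) open
tubular neighbourhood of the submanifold `T(F × 0) ≅ F` with trivial normal bundle.  This file
produces the decomposition of `Y` into the **tube piece** `N = T(F × B̄(0, ½))` and its
**complement** `M = Y ∖ T(F × B(0, ½))`, two compact smooth manifolds with common boundary
`T(F × S(0, ½)) ≅ F × Sᶜ⁻¹`, glued along it — the setting of a *surgery along `F`* (remove `N`,
glue back another piece with the same boundary; for `F = T²`, `c = 2` in a `4`-manifold: torus
surgery, Gompf–Stipsicz 1999 §8.3, Akhmedov–Park 2010 §2) and of the *fibre sum* (glue two such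
complements; Gompf 1995).  Everything is phrased through a **tube function**: a smooth
`g : Y → ℝ` with regular level `¼` which is `‖v‖²` in the tube coordinates `T(f, v)`, `‖v‖² ≤ ½`,
and `≡ 1` off the tube, so that `N = {g ≤ ¼}` and `M = {¼ ≤ g}` are the regular sublevel and
superlevel sets of the tree's `RegularLevelSplitting.lean` (Milnor 1963 Thm. 3.1: `Mᵃ = f⁻¹(-∞, a]`
is a smooth manifold with boundary `f⁻¹(a)`, and `M = Mᵃ ∪ f⁻¹[a, ∞)`):

* `exists_tube_function` — a tube function exists (cut `‖v‖²` off smoothly by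
  `Real.smoothTransition`; smooth on the open tube through the smooth inverse of `T`,
  `Literature.Geometry.Manifold.contMDiffOn_invFun_range`, and `≡ 1` near the closed complement
  of `T(F × B̄(0,1))`; the level `¼` is regular: along the radial curve `s ↦ T(f, (1+s)v)` the
  function is `(1+s)²/4`, with derivative `½ ≠ 0` at `s = 0`);
* `isPreconnected_of_isClosed_cover` — point-set lemma: if `X = A ∪ B` with `A`, `B` closed,
  `X` preconnected and `A ∩ B` preconnected and nonempty, then `A` is preconnected;
* for any tube function `g` (hypotheses `hle`, `hout` below):
  `preimage_Iic_eq_image_tube`, `preimage_Iio_eq_image_tube`, `level_eq_image_tube` (the pieces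
  in tube coordinates), `isConnected_superlevel_tube` / `connectedSpace_regularSuperlevel_tube`
  (the complement `M = {¼ ≤ g}` is connected when `Y` and `F` are and `c ≥ 2`),
  `nonempty_manifoldInterior_regularSublevel_homeomorph_tube` (the interior of the tube piece
  `N = {g ≤ ¼}` is homeomorphic to `F × ℝᶜ`), and in codimension `c = 2`:
  `nonempty_level_homeomorph_prod_addCircle` (the level `{g = ¼} = T(F × S(0, ½))` is `F × S¹`,
  `S¹ = ℝ/ℤ`, the gluing region of the Euler characteristic computations).

With `RegularSublevel.isBoundaryGluing_split` (the tree) this is the input required by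
`Literature.Topology.FourManifolds.SignatureTorusSurgeryFibreSum` /
`…SignatureCupTrivialPieces` (signature under torus surgery and fibre sum) and by the Euler
characteristic computations of
`Literature.Barriers.SmoothPoincare4.SmallExoticaFrontierReductionLemma8Proofs`.
Everything is proved; no definitions, no named facts.

## References

* J. Milnor, *Morse theory*, Princeton 1963, Thm. 3.1. [Milnor1963]
* R. E. Gompf, A. I. Stipsicz, *4-Manifolds and Kirby Calculus*, AMS 1999, §8.3.
  [GompfStipsiczGSM1999]
* A. Akhmedov, B. D. Park, Invent. Math. 181 (2010), §2. [AkhmedovPark2010]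
* R. E. Gompf, Ann. of Math. 142 (1995), §1. [Gompf1995]
-/

noncomputable section

open scoped Manifold ContDiff Topology
open Set Function Filter Metric

namespace Literature.Topology.FourManifolds

/-! ### A point-set lemma -/

/-- **A closed piece of a closed cover with connected overlap is connected**: if `X = A ∪ B`
with `A`, `B` closed, `X` preconnected and `A ∩ B` preconnected and nonempty, then `A` is
preconnected.  (If `A ⊆ C ∪ D` with `C`, `D` closed and `A ∩ C ∩ D = ∅`, the connected `A ∩ B`
lies in `C`, say; then `X = ((A ∩ C) ∪ B) ∪ (A ∩ D)` is a cover by disjoint closed sets, so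
`A ∩ D ⊆ (A ∩ C) ∪ B`, whence `A ⊆ C`.) [folklore] -/
theorem isPreconnected_of_isClosed_cover {X : Type*} [TopologicalSpace X] [PreconnectedSpace X]
    {A B : Set X} (hA : IsClosed A) (hB : IsClosed B) (hAB : A ∪ B = univ)
    (hI : IsPreconnected (A ∩ B)) (hne : (A ∩ B).Nonempty) : IsPreconnected A := by
  rw [isPreconnected_iff_subset_of_disjoint_closed]
  intro C D hC hD hsub hdisj
  rw [isPreconnected_iff_subset_of_disjoint_closed] at hI
  have hI' := hI C D hC hD (inter_subset_left.trans hsub)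
    (by rw [← subset_empty_iff, ← hdisj]; exact inter_subset_inter_left _ inter_subset_left)
  -- without loss of generality `A ∩ B ⊆ C` (the argument is symmetric)
  suffices key : ∀ C D : Set X, IsClosed C → IsClosed D → A ⊆ C ∪ D → A ∩ (C ∩ D) = ∅ →
      A ∩ B ⊆ C → A ⊆ C by
    rcases hI' with h | h
    · exact Or.inl (key C D hC hD hsub hdisj h)
    · refine Or.inr (key D C hD hC (by rwa [union_comm]) (by rwa [inter_comm D C]) h)
  intro C D hC hD hsub hdisj hABC
  -- the closed cover `X = ((A ∩ C) ∪ B) ∪ (A ∩ D)` by disjoint pieces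
  have hcov : (A ∩ C ∪ B) ∪ (A ∩ D) = univ := by
    apply eq_univ_of_forall
    intro x
    by_cases hxA : x ∈ A
    · rcases hsub hxA with hxC | hxD
      · exact Or.inl (Or.inl ⟨hxA, hxC⟩)
      · exact Or.inr ⟨hxA, hxD⟩
    · have hxB : x ∈ B := by
        have := hAB.symm.subset (mem_univ x)
        exact this.resolve_left hxA
      exact Or.inl (Or.inr hxB)
  have hdisj' : (A ∩ C ∪ B) ∩ (A ∩ D) = ∅ := by
    rw [← subset_empty_iff]
    rintro x ⟨hx1 | hx1, hxA, hxD⟩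
    · rw [← hdisj]; exact ⟨hxA, hx1.2, hxD⟩
    · rw [← hdisj]; exact ⟨hxA, hABC ⟨hxA, hx1⟩, hxD⟩
  have huniv := (isPreconnected_iff_subset_of_disjoint_closed.1 isPreconnected_univ)
    (A ∩ C ∪ B) (A ∩ D) ((hA.inter hC).union hB) (hA.inter hD) hcov.symm.subset
    (by rw [univ_inter]; exact hdisj')
  rcases huniv with h | h
  · intro x hxA
    rcases h (mem_univ x) with hx | hxB
    · exact hx.2
    · exact hABC ⟨hxA, hxB⟩
  · -- then `B ⊆ A ∩ D`, so `A ∩ B ⊆ C ∩ D ∩ A = ∅`, contradicting nonemptiness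
    exfalso
    obtain ⟨x, hxA, hxB⟩ := hne
    have hxD : x ∈ D := (h (mem_univ x)).2
    rw [← mem_empty_iff_false x, ← hdisj]
    exact ⟨hxA, hABC ⟨hxA, hxB⟩, hxD⟩

/-! ### Tube functions -/

section TubeFunction

variable {k d c : ℕ}
  {Y : Type} [TopologicalSpace Y] [T2Space Y] [ChartedSpace (EuclideanSpace ℝ (Fin (k + 1))) Y]
  {F : Type} [TopologicalSpace F] [CompactSpace F] [ChartedSpace (EuclideanSpace ℝ (Fin d)) F]
  {T : F × EuclideanSpace ℝ (Fin c) → Y}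

/-- **Existence of a tube function.**  For a smooth open embedding `T : F × ℝᶜ → Y` of the
product of a compact manifold `F` with `ℝᶜ` into a manifold without boundary `Y` there is a smooth
`g : Y → ℝ` with regular level `¼` such that `g(T(f, v)) ≤ ¼ ↔ ‖v‖ ≤ ½`,
`g(T(f, v)) < ¼ ↔ ‖v‖ < ½`, and `g ≡ 1` off the tube.  (Take `g = ρ(‖v‖²)` on the tube and `1`
outside, `ρ(s) = s(1 - σ(s)) + σ(s)`, `σ(s) = smoothTransition(2s - 1)`: `ρ = id` on `s ≤ ½`,
`ρ = 1` on `s ≥ 1`, `ρ ≥ ½` in between.) [cite: Milnor1963, Thm. 3.1 (regular sublevel sets)] -/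
theorem exists_tube_function [Nonempty F]
    (hT : Manifold.IsSmoothEmbedding ((𝓡 d).prod (𝓡 c)) (𝓡 (k + 1)) ∞ T)
    (hTo : IsOpen (range T)) :
    ∃ g : Y → ℝ, IsRegularLevel (𝓡 (k + 1)) g (1 / 4) ∧
      (∀ x, g (T x) ≤ 1 / 4 ↔ ‖x.2‖ ≤ 1 / 2) ∧ (∀ x, g (T x) < 1 / 4 ↔ ‖x.2‖ < 1 / 2) ∧
      (∀ y, y ∉ range T → g y = 1) := by
  classical
  have hinj : Injective T := hT.isEmbedding.injective
  -- the cutoff `ρ`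
  set σ : ℝ → ℝ := fun s => Real.smoothTransition (2 * s - 1) with hσ
  set ρ : ℝ → ℝ := fun s => s * (1 - σ s) + σ s with hρ
  have hσ_smooth : ContDiff ℝ ∞ σ :=
    Real.smoothTransition.contDiff.comp ((contDiff_const.mul contDiff_id).sub contDiff_const)
  have hρ_smooth : ContDiff ℝ ∞ ρ :=
    (contDiff_id.mul (contDiff_const.sub hσ_smooth)).add hσ_smooth
  have hσ0 : ∀ s, s ≤ 1 / 2 → σ s = 0 := fun s hs =>
    Real.smoothTransition.zero_of_nonpos (by linarith)
  have hσ1 : ∀ s, 1 ≤ s → σ s = 1 := fun s hs =>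
    Real.smoothTransition.one_of_one_le (by linarith)
  have hρ_id : ∀ s, s ≤ 1 / 2 → ρ s = s := fun s hs => by
    simp only [hρ, hσ0 s hs]; ring
  have hρ_one : ∀ s, 1 ≤ s → ρ s = 1 := fun s hs => by
    simp only [hρ, hσ1 s hs]; ring
  have hρ_half : ∀ s, 1 / 2 ≤ s → 1 / 2 ≤ ρ s := fun s hs => by
    have h0 : 0 ≤ σ s := Real.smoothTransition.nonneg _
    have h1 : σ s ≤ 1 := Real.smoothTransition.le_one _
    simp only [hρ]
    nlinarith
  have hρ_le_iff : ∀ s, ρ s ≤ 1 / 4 ↔ s ≤ 1 / 4 := fun s => by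
    rcases le_or_gt s (1 / 2) with hs | hs
    · rw [hρ_id s hs]
    · constructor
      · intro h; have := hρ_half s hs.le; linarith
      · intro h; linarith
  have hρ_lt_iff : ∀ s, ρ s < 1 / 4 ↔ s < 1 / 4 := fun s => by
    rcases le_or_gt s (1 / 2) with hs | hs
    · rw [hρ_id s hs]
    · constructor
      · intro h; have := hρ_half s hs.le; linarith
      · intro h; linarith
  have hρ_eq_iff : ∀ s, ρ s = 1 / 4 ↔ s = 1 / 4 := fun s => by
    constructor
    · intro h
      exact le_antisymm ((hρ_le_iff s).1 h.le) (not_lt.1 fun h' => ((hρ_lt_iff s).2 h').ne h)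
    · intro h; rw [hρ_id s (by rw [h]; norm_num), h]
  -- the model function `q (f, v) = ρ (‖v‖²)` on `F × ℝᶜ`
  set q : F × EuclideanSpace ℝ (Fin c) → ℝ := fun x => ρ (‖x.2‖ ^ 2) with hq
  have hq_smooth : ContMDiff ((𝓡 d).prod (𝓡 c)) 𝓘(ℝ, ℝ) ∞ q :=
    (hρ_smooth.comp (contDiff_norm_sq ℝ)).comp_contMDiff contMDiff_snd
  -- norms vs squares
  have hsq_le : ∀ v : EuclideanSpace ℝ (Fin c), ‖v‖ ^ 2 ≤ 1 / 4 ↔ ‖v‖ ≤ 1 / 2 := fun v => by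
    rw [show (1 / 4 : ℝ) = (1 / 2) ^ 2 by norm_num]
    exact pow_le_pow_iff_left₀ (norm_nonneg v) (by norm_num) two_ne_zero
  have hsq_lt : ∀ v : EuclideanSpace ℝ (Fin c), ‖v‖ ^ 2 < 1 / 4 ↔ ‖v‖ < 1 / 2 := fun v => by
    rw [show (1 / 4 : ℝ) = (1 / 2) ^ 2 by norm_num]
    exact pow_lt_pow_iff_left₀ (norm_nonneg v) (by norm_num) two_ne_zero
  -- the tube function
  refine ⟨fun y => if y ∈ range T then q (invFun T y) else 1, ?_, ?_, ?_, ?_⟩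
  rotate_left
  · intro x
    simp only [mem_range_self, if_true, leftInverse_invFun hinj x, hq, hρ_le_iff, hsq_le]
  · intro x
    simp only [mem_range_self, if_true, leftInverse_invFun hinj x, hq, hρ_lt_iff, hsq_lt]
  · intro y hy
    simp only [hy, if_false]
  -- regularity
  have hginT : ∀ x, (if T x ∈ range T then q (invFun T (T x)) else 1) = q x := fun x => by
    simp only [mem_range_self, if_true, leftInverse_invFun hinj x]
  have hg : ContMDiff (𝓡 (k + 1)) 𝓘(ℝ, ℝ) ∞
      (fun y => if y ∈ range T then q (invFun T y) else 1) := by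
    intro y
    by_cases hy : y ∈ range T
    · have h1 : ContMDiffAt (𝓡 (k + 1)) ((𝓡 d).prod (𝓡 c)) ∞ (invFun T) y :=
        (Literature.Geometry.Manifold.contMDiffOn_invFun_range hT y hy).contMDiffAt
          (hTo.mem_nhds hy)
      have h2 : ContMDiffAt (𝓡 (k + 1)) 𝓘(ℝ, ℝ) ∞ (q ∘ invFun T) y := (hq_smooth _).comp y h1
      refine h2.congr_of_eventuallyEq ?_
      filter_upwards [hTo.mem_nhds hy] with y' hy'
      simp only [hy', if_true, comp_apply]
    · have hK : IsCompact (T '' ((univ : Set F) ×ˢ closedBall (0 : EuclideanSpace ℝ (Fin c)) 1)) :=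
        (isCompact_univ.prod (isCompact_closedBall 0 1)).image hT.contMDiff.continuous
      have hyK : y ∉ T '' ((univ : Set F) ×ˢ closedBall (0 : EuclideanSpace ℝ (Fin c)) 1) :=
        fun ⟨x, _, hx⟩ => hy ⟨x, hx⟩
      refine (contMDiffAt_const (c := (1 : ℝ))).congr_of_eventuallyEq ?_
      filter_upwards [hK.isClosed.isOpen_compl.mem_nhds hyK] with y' hy'
      by_cases hy'' : y' ∈ range T
      · obtain ⟨x, rfl⟩ := hy''
        rw [hginT]
        have hx1 : 1 < ‖x.2‖ := by
          by_contra hle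
          exact hy' ⟨x, ⟨mem_univ _, mem_closedBall_zero_iff.2 (not_lt.1 hle)⟩, rfl⟩
        show ρ (‖x.2‖ ^ 2) = 1
        exact hρ_one _ (by nlinarith)
      · simp only [hy'', if_false]
  refine isRegularLevel_of_not_isMCriticalPt hg fun y hy hcrit => ?_
  -- a point of the level lies in the tube, at radius `½`
  obtain ⟨x, rfl⟩ : y ∈ range T := by
    by_contra h
    simp only [h, if_false] at hy
    norm_num at hy
  rw [hginT] at hy
  have hx2 : ‖x.2‖ ^ 2 = 1 / 4 := (hρ_eq_iff _).1 hy
  -- the radial curve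
  set γ : ℝ → Y := fun s => T (x.1, (1 + s) • x.2) with hγ
  have hγ_smooth : ContMDiff 𝓘(ℝ, ℝ) (𝓡 (k + 1)) ∞ γ :=
    hT.contMDiff.comp (contMDiff_const.prodMk ((contMDiff_const.add contMDiff_id).smul
      contMDiff_const))
  have hγ0 : γ 0 = T x := by simp only [hγ, add_zero, one_smul, Prod.mk.eta]
  have hcomp : ∀ s, (if γ s ∈ range T then q (invFun T (γ s)) else 1) =
      ρ ((1 + s) ^ 2 * ‖x.2‖ ^ 2) := fun s => by
    simp only [hγ]
    rw [hginT]
    simp only [hq, norm_smul, mul_pow, Real.norm_eq_abs, sq_abs]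
  have hev : ((fun y => if y ∈ range T then q (invFun T y) else 1) ∘ γ) =ᶠ[𝓝 0]
      fun s => (1 + s) ^ 2 / 4 := by
    filter_upwards [Metric.ball_mem_nhds (0 : ℝ) (show (0 : ℝ) < 1 / 4 by norm_num)] with s hs
    rw [comp_apply, hcomp, hx2, hρ_id]
    · ring
    · rw [Metric.mem_ball, Real.dist_eq, sub_zero, abs_lt] at hs
      nlinarith
  -- chain rule: the derivative of `g ∘ γ` at `0` vanishes
  have hmd : mfderiv 𝓘(ℝ, ℝ) 𝓘(ℝ, ℝ)
      ((fun y => if y ∈ range T then q (invFun T y) else 1) ∘ γ) 0 = 0 := by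
    rw [mfderiv_comp 0 (by rw [hγ0]; exact (hg _).mdifferentiableAt (by simp))
      ((hγ_smooth 0).mdifferentiableAt (by simp))]
    have hc : mfderiv (𝓡 (k + 1)) 𝓘(ℝ, ℝ)
        (fun y => if y ∈ range T then q (invFun T y) else 1) (γ 0) = 0 := by
      rw [hγ0]; exact hcrit
    rw [hc, ContinuousLinearMap.zero_comp]
    rfl
  -- but it is the derivative `½` of `(1 + s)²/4`
  have hlin : HasDerivAt (fun s : ℝ => 1 + s) 1 0 := (hasDerivAt_id (0 : ℝ)).const_add 1
  have hpoly : HasDerivAt (fun s : ℝ => (1 + s) ^ 2 / 4)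
      (((2 : ℕ) : ℝ) * (1 + 0) ^ (2 - 1) * 1 / 4) 0 :=
    (hlin.fun_pow 2).div_const 4
  have hmd' : mfderiv 𝓘(ℝ, ℝ) 𝓘(ℝ, ℝ) (fun s : ℝ => (1 + s) ^ 2 / 4) 0 = 0 := by
    rw [← hev.mfderiv_eq]; exact hmd
  rw [mfderiv_eq_fderiv] at hmd'
  have h1 : deriv (fun s : ℝ => (1 + s) ^ 2 / 4) 0 = 0 := by
    rw [← fderiv_apply_one_eq_deriv, hmd']; rfl
  rw [hpoly.deriv] at h1
  norm_num at h1

end TubeFunction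

/-! ### The pieces in tube coordinates -/

section TubePieces

variable {k c : ℕ} {Y : Type} {F : Type} {T : F × EuclideanSpace ℝ (Fin c) → Y} {g : Y → ℝ}

/-- For a tube function, the sublevel set `{g ≤ ¼}` is the closed tube `T(F × B̄(0, ½))`.
[folklore] -/
theorem preimage_Iic_eq_image_tube (hle : ∀ x, g (T x) ≤ 1 / 4 ↔ ‖x.2‖ ≤ 1 / 2)
    (hout : ∀ y, y ∉ range T → g y = 1) :
    g ⁻¹' Iic (1 / 4) = T '' {x | ‖x.2‖ ≤ 1 / 2} := by
  ext y
  constructor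
  · intro hy
    obtain ⟨x, rfl⟩ : y ∈ range T := by
      by_contra h
      have := hout y h
      simp only [mem_preimage, mem_Iic] at hy
      linarith
    exact ⟨x, (hle x).1 hy, rfl⟩
  · rintro ⟨x, hx, rfl⟩
    exact (hle x).2 hx

/-- For a tube function, `{g < ¼}` is the open tube `T(F × B(0, ½))`. [folklore] -/
theorem preimage_Iio_eq_image_tube (hlt : ∀ x, g (T x) < 1 / 4 ↔ ‖x.2‖ < 1 / 2)
    (hout : ∀ y, y ∉ range T → g y = 1) :
    g ⁻¹' Iio (1 / 4) = T '' {x | ‖x.2‖ < 1 / 2} := by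
  ext y
  constructor
  · intro hy
    obtain ⟨x, rfl⟩ : y ∈ range T := by
      by_contra h
      have := hout y h
      simp only [mem_preimage, mem_Iio] at hy
      linarith
    exact ⟨x, (hlt x).1 hy, rfl⟩
  · rintro ⟨x, hx, rfl⟩
    exact (hlt x).2 hx

/-- For a tube function, the level `{g = ¼}` is the sphere bundle `T(F × S(0, ½))`. [folklore] -/
theorem level_eq_image_tube (hle : ∀ x, g (T x) ≤ 1 / 4 ↔ ‖x.2‖ ≤ 1 / 2)
    (hlt : ∀ x, g (T x) < 1 / 4 ↔ ‖x.2‖ < 1 / 2) (hout : ∀ y, y ∉ range T → g y = 1) :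
    g ⁻¹' {1 / 4} = T '' ((univ : Set F) ×ˢ sphere (0 : EuclideanSpace ℝ (Fin c)) (1 / 2)) := by
  ext y
  constructor
  · intro hy
    simp only [mem_preimage, mem_singleton_iff] at hy
    obtain ⟨x, rfl⟩ : y ∈ range T := by
      by_contra h
      have := hout y h
      linarith
    refine ⟨x, ⟨mem_univ _, ?_⟩, rfl⟩
    rw [mem_sphere_zero_iff_norm]
    exact le_antisymm ((hle x).1 hy.le) (not_lt.1 fun h' => ((hlt x).2 h').ne hy)
  · rintro ⟨x, ⟨-, hx⟩, rfl⟩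
    rw [mem_sphere_zero_iff_norm] at hx
    simp only [mem_preimage, mem_singleton_iff]
    exact le_antisymm ((hle x).2 hx.le) (not_lt.1 fun h' => ((hlt x).1 h').ne hx)

variable [TopologicalSpace Y] [TopologicalSpace F]

/-- **The complement `M = {¼ ≤ g}` of the open tube is connected** when `Y` and `F` are connected
and the fibre has dimension `c ≥ 2`: `Y = {¼ ≤ g} ∪ {g ≤ ¼}` is a closed cover whose overlap
`{g = ¼} = T(F × S(0, ½))` is connected (`F` and the sphere `Sᶜ⁻¹` are), so
`isPreconnected_of_isClosed_cover` applies (the complement of a tubular neighbourhood of a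
codimension-`≥ 2` submanifold of a connected manifold is connected). [folklore] -/
theorem isConnected_preimage_Ici_tube [ConnectedSpace Y] [ConnectedSpace F] (hc : 2 ≤ c)
    (hT : Continuous T) (hg : Continuous g) (hle : ∀ x, g (T x) ≤ 1 / 4 ↔ ‖x.2‖ ≤ 1 / 2)
    (hlt : ∀ x, g (T x) < 1 / 4 ↔ ‖x.2‖ < 1 / 2) (hout : ∀ y, y ∉ range T → g y = 1) :
    IsConnected (g ⁻¹' Ici (1 / 4)) := by
  have hrank : 1 < Module.rank ℝ (EuclideanSpace ℝ (Fin c)) := by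
    rw [← Module.finrank_eq_rank, finrank_euclideanSpace_fin, Nat.one_lt_cast]
    omega
  have hlevel : IsConnected (g ⁻¹' Ici (1 / 4) ∩ g ⁻¹' Iic (1 / 4)) := by
    have heq : g ⁻¹' Ici (1 / 4) ∩ g ⁻¹' Iic (1 / 4) = g ⁻¹' {1 / 4} := by
      ext y
      simp only [mem_inter_iff, mem_preimage, mem_Ici, mem_Iic, mem_singleton_iff]
      constructor
      · rintro ⟨h1, h2⟩; exact le_antisymm h2 h1
      · intro h; rw [h]; exact ⟨le_rfl, le_rfl⟩
    rw [heq, level_eq_image_tube hle hlt hout]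
    exact (isConnected_univ.prod (isConnected_sphere hrank 0 (by norm_num))).image T
      hT.continuousOn
  refine ⟨hlevel.nonempty.mono inter_subset_left, ?_⟩
  refine isPreconnected_of_isClosed_cover (isClosed_Ici.preimage hg) (isClosed_Iic.preimage hg)
    ?_ hlevel.isPreconnected hlevel.nonempty
  exact eq_univ_of_forall fun y => (le_total (1 / 4) (g y)).imp id id

variable [ChartedSpace (EuclideanSpace ℝ (Fin (k + 1))) Y] [IsManifold (𝓡 (k + 1)) ∞ Y]

omit [IsManifold (𝓡 (k + 1)) ∞ Y] in
/-- **The tube complement as a regular superlevel set is connected**: for a tube function with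
regular level `¼`, the compact manifold with boundary `M = {¼ ≤ g}`
(`Literature.Topology.FourManifolds.RegularSuperlevel`) is a connected space, when `Y` and `F`
are connected and `c ≥ 2`. [folklore] -/
theorem connectedSpace_regularSuperlevel_tube [ConnectedSpace Y] [ConnectedSpace F] (hc : 2 ≤ c)
    (hT : Continuous T) (hreg : IsRegularLevel (𝓡 (k + 1)) g (1 / 4))
    (hle : ∀ x, g (T x) ≤ 1 / 4 ↔ ‖x.2‖ ≤ 1 / 2) (hlt : ∀ x, g (T x) < 1 / 4 ↔ ‖x.2‖ < 1 / 2)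
    (hout : ∀ y, y ∉ range T → g y = 1) : ConnectedSpace (RegularSuperlevel hreg) := by
  have hcon := isConnected_preimage_Ici_tube hc hT hreg.contMDiff.continuous hle hlt hout
  have heq : (fun y => 1 / 4 - g y) ⁻¹' Iic 0 = g ⁻¹' Ici (1 / 4) := by
    ext y
    simp only [mem_preimage, mem_Iic, mem_Ici, sub_nonpos]
  haveI : ConnectedSpace ↥(g ⁻¹' Ici (1 / 4)) := isConnected_iff_connectedSpace.1 hcon
  let e : ↥(g ⁻¹' Ici (1 / 4)) ≃ₜ ↥((fun y => 1 / 4 - g y) ⁻¹' Iic (0 : ℝ)) :=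
    Homeomorph.setCongr heq.symm
  unfold RegularSuperlevel RegularSublevel
  exact e.surjective.connectedSpace e.continuous

/-- **The interior of the tube piece `N = {g ≤ ¼}` is homeomorphic to `F × ℝᶜ`**: the interior
of the regular sublevel set is `{g < ¼}` (Milnor 1963, Thm. 3.1), which `T` identifies with
`F × B(0, ½) ≅ F × ℝᶜ`.  This is the hypothesis "`int N ≅ F × E`" of
`Literature.Topology.FourManifolds.SignatureCupTrivialPieces` for the solid piece of a torus
surgery / a fibre sum. [cite: Milnor1963, Thm. 3.1] -/
theorem nonempty_manifoldInterior_regularSublevel_homeomorph_tube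
    (hT : Topology.IsEmbedding T) (hreg : IsRegularLevel (𝓡 (k + 1)) g (1 / 4))
    (hlt : ∀ x, g (T x) < 1 / 4 ↔ ‖x.2‖ < 1 / 2) (hout : ∀ y, y ∉ range T → g y = 1) :
    Nonempty (ManifoldInterior k (RegularSublevel hreg) ≃ₜ F × EuclideanSpace ℝ (Fin c)) := by
  -- Step A: the interior is `{g < ¼}`
  let eA : ManifoldInterior k (RegularSublevel hreg) ≃ₜ {y : Y // g y < 1 / 4} :=
    { toFun := fun p => ⟨RegularSublevel.incl hreg p.1,
        (RegularSublevel.isInteriorPoint_iff hreg p.1).1 p.2⟩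
      invFun := fun y => ⟨RegularSublevel.mk hreg y.1 y.2.le,
        (RegularSublevel.isInteriorPoint_iff hreg _).2 y.2⟩
      left_inv := fun p => rfl
      right_inv := fun y => rfl
      continuous_toFun := ((RegularSublevel.continuous_incl hreg).comp
        continuous_subtype_val).subtype_mk _
      continuous_invFun := by
        refine Continuous.subtype_mk ?_ _
        exact (RegularSublevel.isEmbedding_incl hreg).continuous_iff.2
          (by exact continuous_subtype_val) }
  -- Step B: `{g < ¼} ≅ {x : F × ℝᶜ // ‖x.2‖ < ½}` along `T`
  have hsub : ∀ y : Y, g y < 1 / 4 → y ∈ range T := fun y hy => by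
    by_contra h
    have := hout y h
    linarith
  let e₀ : F × EuclideanSpace ℝ (Fin c) ≃ₜ ↥(range T) := hT.toHomeomorph
  let eB₁ : {x : F × EuclideanSpace ℝ (Fin c) // ‖x.2‖ < 1 / 2} ≃ₜ
      {z : ↥(range T) // g z.1 < 1 / 4} :=
    e₀.subtype fun x => by
      rw [Topology.IsEmbedding.toHomeomorph_apply_coe]
      exact (hlt x).symm
  let eB₂ : {z : ↥(range T) // g z.1 < 1 / 4} ≃ₜ {y : Y // g y < 1 / 4} :=
    { toFun := fun z => ⟨z.1.1, z.2⟩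
      invFun := fun y => ⟨⟨y.1, hsub y.1 y.2⟩, y.2⟩
      left_inv := fun z => rfl
      right_inv := fun y => rfl
      continuous_toFun := (continuous_subtype_val.comp continuous_subtype_val).subtype_mk _
      continuous_invFun := (continuous_subtype_val.subtype_mk _).subtype_mk _ }
  -- Step C: `{x : F × ℝᶜ // ‖x.2‖ < ½} ≅ F × B(0, ½) ≅ F × ℝᶜ`
  have hset : {x : F × EuclideanSpace ℝ (Fin c) | ‖x.2‖ < 1 / 2} =
      (univ : Set F) ×ˢ ball (0 : EuclideanSpace ℝ (Fin c)) (1 / 2) := by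
    ext x
    simp only [mem_setOf_eq, mem_prod, mem_univ, true_and, mem_ball_zero_iff]
  let eBall : ↥(ball (0 : EuclideanSpace ℝ (Fin c)) (1 / 2)) ≃ₜ EuclideanSpace ℝ (Fin c) :=
    (Homeomorph.setCongr (OpenPartialHomeomorph.univBall_target (0 : EuclideanSpace ℝ (Fin c))
        (show (0 : ℝ) < 1 / 2 by norm_num))).symm.trans
      ((OpenPartialHomeomorph.univBall (0 : EuclideanSpace ℝ (Fin c)) (1 / 2)
          ).toHomeomorphSourceTarget.symm.trans
        ((Homeomorph.setCongr (OpenPartialHomeomorph.univBall_source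
            (0 : EuclideanSpace ℝ (Fin c)) (1 / 2))).trans (Homeomorph.Set.univ _)))
  let eC : {x : F × EuclideanSpace ℝ (Fin c) // ‖x.2‖ < 1 / 2} ≃ₜ F × EuclideanSpace ℝ (Fin c) :=
    (Homeomorph.setCongr hset).trans ((Homeomorph.Set.prod _ _).trans
      ((Homeomorph.Set.univ F).prodCongr eBall))
  exact ⟨eA.trans (eB₂.symm.trans (eB₁.symm.trans eC))⟩

omit [ChartedSpace (EuclideanSpace ℝ (Fin (k + 1))) Y] [IsManifold (𝓡 (k + 1)) ∞ Y] in
/-- **The tube piece in tube coordinates**: for a tube function of an embedding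
`T : F × ℝᶜ → Y`, the sublevel set `{g ≤ ¼} = T(F × B̄(0, ½))` is homeomorphic to
`F × B̄(0, ½)` — the closed tubular neighbourhood `F × D` (whose Euler characteristic is
`χ(F)`, `FinRelHomology.prod_closedBall`). [folklore] -/
theorem nonempty_sublevel_homeomorph_prod_closedBall (hT : Topology.IsEmbedding T)
    (hle : ∀ x, g (T x) ≤ 1 / 4 ↔ ‖x.2‖ ≤ 1 / 2) (hout : ∀ y, y ∉ range T → g y = 1) :
    Nonempty (↥(g ⁻¹' Iic (1 / 4)) ≃ₜ
      F × ↥(closedBall (0 : EuclideanSpace ℝ (Fin c)) (1 / 2))) := by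
  have hset : {x : F × EuclideanSpace ℝ (Fin c) | ‖x.2‖ ≤ 1 / 2} =
      (univ : Set F) ×ˢ closedBall (0 : EuclideanSpace ℝ (Fin c)) (1 / 2) := by
    ext x
    simp only [mem_setOf_eq, mem_prod, mem_univ, true_and, mem_closedBall_zero_iff]
  rw [preimage_Iic_eq_image_tube hle hout, hset]
  have hemb : Topology.IsEmbedding (T ∘ (Subtype.val :
      ↥((univ : Set F) ×ˢ closedBall (0 : EuclideanSpace ℝ (Fin c)) (1 / 2)) → F × _)) :=
    hT.comp Topology.IsEmbedding.subtypeVal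
  have hrange : range (T ∘ (Subtype.val :
      ↥((univ : Set F) ×ˢ closedBall (0 : EuclideanSpace ℝ (Fin c)) (1 / 2)) → F × _)) =
      T '' ((univ : Set F) ×ˢ closedBall (0 : EuclideanSpace ℝ (Fin c)) (1 / 2)) := by
    rw [range_comp, Subtype.range_coe]
  exact ⟨(hemb.toHomeomorph.trans (Homeomorph.setCongr hrange)).symm.trans
    ((Homeomorph.Set.prod _ _).trans ((Homeomorph.Set.univ F).prodCongr (Homeomorph.refl _)))⟩

omit [IsManifold (𝓡 (k + 1)) ∞ Y] in
/-- **The tube complement as a subset**: the superlevel set `{¼ ≤ g}` of `Y` is homeomorphic to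
the regular superlevel manifold `M = RegularSuperlevel` (the inclusion is an embedding with this
range). [folklore] -/
theorem nonempty_preimage_Ici_homeomorph_regularSuperlevel
    (hreg : IsRegularLevel (𝓡 (k + 1)) g (1 / 4)) :
    Nonempty (↥(g ⁻¹' Ici (1 / 4)) ≃ₜ RegularSuperlevel hreg) := by
  have heq : (fun y => 1 / 4 - g y) ⁻¹' Iic 0 = g ⁻¹' Ici (1 / 4) := by
    ext y
    simp only [mem_preimage, mem_Iic, mem_Ici, sub_nonpos]
  let e : ↥(g ⁻¹' Ici (1 / 4)) ≃ₜ ↥((fun y => 1 / 4 - g y) ⁻¹' Iic (0 : ℝ)) :=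
    Homeomorph.setCongr heq.symm
  unfold RegularSuperlevel RegularSublevel
  exact ⟨e⟩

/-- **The boundary of the tube complement is the level**: `∂M ≅ {g = ¼}` for the regular
superlevel manifold `M = {¼ ≤ g}` (Milnor 1963, Thm. 3.1: `∂Mᵃ = f⁻¹(a)`), hence `≅ F × S¹` in
codimension two (`nonempty_level_homeomorph_prod_addCircle`). [cite: Milnor1963, Thm. 3.1] -/
theorem nonempty_boundary_regularSuperlevel_homeomorph_level
    (hreg : IsRegularLevel (𝓡 (k + 1)) g (1 / 4)) :
    Nonempty (↥((𝓡∂ (k + 1)).boundary (RegularSuperlevel hreg)) ≃ₜ ↥(g ⁻¹' {1 / 4})) := by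
  have h1 : ∀ p : ↥((𝓡∂ (k + 1)).boundary (RegularSuperlevel hreg)),
      RegularSublevel.incl hreg.const_sub p.1 ∈ g ⁻¹' {1 / 4} := fun p => by
    have h : 1 / 4 - g (RegularSublevel.incl hreg.const_sub p.1) = 0 :=
      (RegularSublevel.mem_boundary_iff hreg.const_sub p.1).1 p.2
    simp only [mem_preimage, mem_singleton_iff]
    linarith
  have h2 : ∀ y : ↥(g ⁻¹' {1 / 4}), (fun y' => 1 / 4 - g y') y.1 ≤ 0 := fun y => by
    have hy := y.2
    simp only [mem_preimage, mem_singleton_iff] at hy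
    show 1 / 4 - g y.1 ≤ 0
    rw [hy]; norm_num
  have h3 : ∀ y : ↥(g ⁻¹' {1 / 4}),
      RegularSublevel.mk hreg.const_sub y.1 (h2 y) ∈
        (𝓡∂ (k + 1)).boundary (RegularSuperlevel hreg) := fun y => by
    refine (RegularSublevel.mem_boundary_iff hreg.const_sub _).2 ?_
    have hy := y.2
    simp only [mem_preimage, mem_singleton_iff] at hy
    show 1 / 4 - g y.1 = 0
    rw [hy]; norm_num
  have hc : Continuous fun y : ↥(g ⁻¹' {1 / 4}) => RegularSublevel.mk hreg.const_sub y.1 (h2 y) :=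
    (RegularSublevel.isEmbedding_incl hreg.const_sub).continuous_iff.2
      (by exact continuous_subtype_val)
  exact ⟨{ toFun := fun p => ⟨RegularSublevel.incl hreg.const_sub p.1, h1 p⟩
           invFun := fun y => ⟨RegularSublevel.mk hreg.const_sub y.1 (h2 y), h3 y⟩
           left_inv := fun p => rfl
           right_inv := fun y => rfl
           continuous_toFun := ((RegularSublevel.continuous_incl hreg.const_sub).comp
             continuous_subtype_val).subtype_mk _
           continuous_invFun := hc.subtype_mk _ }⟩

end TubePieces

/-! ### Codimension two: the level is `F × S¹` -/

section Circle

/-- A round circle `S(0, r)`, `r > 0`, in the Euclidean plane `ℝ²` is homeomorphic to the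
additive circle `ℝ/ℤ` (through `ℝ² ≅ ℂ`, the scaling `z ↦ r⁻¹ z` onto the unit circle, and
Mathlib's `AddCircle.homeomorphCircle`). [folklore] -/
theorem nonempty_sphere_euclideanTwo_homeomorph_addCircle {r : ℝ} (hr : 0 < r) :
    Nonempty (↥(sphere (0 : EuclideanSpace ℝ (Fin 2)) r) ≃ₜ AddCircle (1 : ℝ)) := by
  -- `ℝ² ≅ ℂ` isometrically, `S(0, r) ↦ S(0, r)`
  let e₁ : EuclideanSpace ℝ (Fin 2) ≃ₗᵢ[ℝ] ℂ := Complex.orthonormalBasisOneI.repr.symm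
  have h₁ : e₁.toHomeomorph '' sphere 0 r = sphere 0 r := by
    have := e₁.toIsometryEquiv.image_sphere 0 r
    rw [LinearIsometryEquiv.coe_toIsometryEquiv, map_zero] at this
    exact this
  let f₁ : ↥(sphere (0 : EuclideanSpace ℝ (Fin 2)) r) ≃ₜ ↥(sphere (0 : ℂ) r) :=
    (e₁.toHomeomorph.image _).trans (Homeomorph.setCongr h₁)
  -- scaling onto the unit circle
  let sc : ℂ ≃ₜ ℂ := Homeomorph.smulOfNeZero (r⁻¹ : ℝ) (inv_ne_zero hr.ne')
  have h₂ : sc '' sphere 0 r = sphere 0 1 := by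
    show (fun z : ℂ => (r⁻¹ : ℝ) • z) '' sphere 0 r = sphere 0 1
    rw [image_smul, smul_sphere' (inv_ne_zero hr.ne'), smul_zero, norm_inv,
      Real.norm_of_nonneg hr.le, inv_mul_cancel₀ hr.ne']
  let f₂ : ↥(sphere (0 : ℂ) r) ≃ₜ ↥(sphere (0 : ℂ) 1) := (sc.image _).trans (Homeomorph.setCongr h₂)
  -- the unit circle of `ℂ` is Mathlib's `Circle ≅ AddCircle 1`
  let f₃ : ↥(sphere (0 : ℂ) 1) ≃ₜ AddCircle (1 : ℝ) :=
    (AddCircle.homeomorphCircle (one_ne_zero : (1 : ℝ) ≠ 0)).symm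
  exact ⟨f₁.trans (f₂.trans f₃)⟩

variable {Y : Type} {F : Type} {T : F × EuclideanSpace ℝ (Fin 2) → Y} {g : Y → ℝ}
  [TopologicalSpace Y] [TopologicalSpace F]

/-- **In codimension two the common boundary of the tube piece and its complement is `F × S¹`**:
for a tube function of an embedding `T : F × ℝ² → Y`, the level `{g = ¼} = T(F × S(0, ½))` is
homeomorphic to `F × (ℝ/ℤ)` — the form of the gluing region used by the Euler characteristic
computations of `Literature.Barriers.SmoothPoincare4.SmallExoticaFrontierReductionLemma8Proofs`
(`…_of_cover_circle`, `…_of_cover_surface`). [folklore] -/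
theorem nonempty_level_homeomorph_prod_addCircle (hT : Topology.IsEmbedding T)
    (hle : ∀ x, g (T x) ≤ 1 / 4 ↔ ‖x.2‖ ≤ 1 / 2) (hlt : ∀ x, g (T x) < 1 / 4 ↔ ‖x.2‖ < 1 / 2)
    (hout : ∀ y, y ∉ range T → g y = 1) :
    Nonempty (↥(g ⁻¹' {1 / 4}) ≃ₜ F × AddCircle (1 : ℝ)) := by
  rw [level_eq_image_tube hle hlt hout]
  have hemb : Topology.IsEmbedding (T ∘ (Subtype.val :
      ↥((univ : Set F) ×ˢ sphere (0 : EuclideanSpace ℝ (Fin 2)) (1 / 2)) → F × _)) :=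
    hT.comp Topology.IsEmbedding.subtypeVal
  have hrange : range (T ∘ (Subtype.val :
      ↥((univ : Set F) ×ˢ sphere (0 : EuclideanSpace ℝ (Fin 2)) (1 / 2)) → F × _)) =
      T '' ((univ : Set F) ×ˢ sphere (0 : EuclideanSpace ℝ (Fin 2)) (1 / 2)) := by
    rw [range_comp, Subtype.range_coe]
  obtain ⟨eS⟩ :=
    nonempty_sphere_euclideanTwo_homeomorph_addCircle (show (0 : ℝ) < 1 / 2 by norm_num)
  exact ⟨(hemb.toHomeomorph.trans (Homeomorph.setCongr hrange)).symm.trans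
    ((Homeomorph.Set.prod _ _).trans ((Homeomorph.Set.univ F).prodCongr eS))⟩

end Circle

end Literature.Topology.FourManifolds

end
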